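import Summits.KontsevichZagierPeriods.KontsevichZagierPeriods.Theorems.LinRedNormalFormArrangementNormalFormStubRebaseSimplePosPull

/-!
# Stub `stub_rebaseSimplePos` (crux `ArrangementNormalForm`, line `janus-bands`, v6) — part `Product`

The PRODUCT-FIBRE sub-case of `stub_rebaseSimplePos` (rebase with a simple base pole over a
base of dimension `B + 1` with `K` fibres), uniformly in the silent base coordinates `x'`:
if every fibre has affine bounds (no mutual bound between fibres) and every lettered fibre has
one of its two bounds parallel to its letter in `y`, then ONE per-fibre affine pull-back
(part `Pull`: shear each fibre along its letter so that the letter becomes `y`-free, rescale the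
other bound to the coordinate `y` itself and shift by its `x'`-part) lands literally in the
rebased class `GG B 2 K` (`RebasePos.good_product`; registered on the literal class text as
`rebaseSimplePos_product`). Fibres with two letter-transverse bounds and nested fibres are NOT
covered (they need Janus splits / rule 1b; see parts `Cells`, `Janus`).

References: M. Kontsevich, D. Zagier, *Periods* (2001), §1.2.
-/

noncomputable section

open Set MeasureTheory MvPolynomial
open Literature.NumberTheory.Transcendental Literature.ModelTheory.ExponentialFields

namespace Summit.KontsevichZagierPeriods.ArrangementNormalForm.JanusBands

namespace RebasePos

open SeparatePos

section Product

variable {B K : ℕ}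

/-- **Packaging.** Literal data with `y`-free letters and affine bounds `y`-free or `y` itself
define an element of `GG B 2 K`. -/
theorem mem_GGset_two {m m' n₁ n₂ : ℕ} (s : KZ.IntegralRep (B + 1 + K))
    (M : Fin m' → (Fin (B + 1) → ℚ) × ℚ) (L : Fin m → (Fin B → ℚ) × ℚ) (e : Fin m → ℕ)
    (p : MvPolynomial (Fin B) ℚ) (ℓ₁ ℓ₂ : (Fin B → ℚ) × ℚ)
    (a : Fin K → Option ((Fin (B + 1) → ℚ) × ℚ)) (lo hi : Fin K → Fin K ⊕ ((Fin (B + 1) → ℚ) × ℚ))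
    (h12 : n₁ = 0 ∨ n₂ = 0) (ha : ∀ i c, a i = some c → c.1 (Fin.last B) = 0)
    (hb : ∀ i c, (lo i = Sum.inr c ∨ hi i = Sum.inr c) →
      (c.1 (Fin.last B) = 0 ∨ c = (Pi.single (Fin.last B) 1, 0)))
    (hbd : Bornology.IsBounded s.domain) (hdom : s.domain = gDom B K m' M lo hi)
    (hint : EqOn s.integrand (glit B K p L e ℓ₁ ℓ₂ n₁ n₂ a) s.domain) :
    KZ.of s ∈ GGset B 2 K :=
  ⟨m, m', n₁, n₂, s, M, L, e, p, ℓ₁, ℓ₂, a, lo, hi, h12, fun _ => ⟨ha, hb⟩, hbd, hdom, hint, rfl⟩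

/-- The `y`-coefficient of a pulled-back form. -/
theorem pullC_fst_last (μ α : ℚ) (δ : (Fin B → ℚ) × ℚ) (c : (Fin (B + 1) → ℚ) × ℚ) :
    (pullC μ α δ c).1 (Fin.last B) = (c.1 (Fin.last B) - α) / μ := by
  simp [pullC]

/-- A bound of `y`-slope `μ` (after the shear `α`), pulled back along itself, is `y` itself. -/
theorem pullC_eq_single (μ α : ℚ) (hμ : μ ≠ 0) (c : (Fin (B + 1) → ℚ) × ℚ)
    (hc : c.1 (Fin.last B) - α = μ) :
    pullC μ α (fun j => c.1 (Fin.castSucc j), c.2) c = (Pi.single (Fin.last B) 1, 0) := by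
  refine Prod.ext (funext fun j => ?_) ?_
  · refine Fin.lastCases ?_ (fun j => ?_) j
    · simp [pullC, hc, hμ]
    · simp [pullC, (Fin.castSucc_lt_last j).ne]
  · simp [pullC]

variable (a : Fin K → Option ((Fin (B + 1) → ℚ) × ℚ)) (u v : Fin K → (Fin (B + 1) → ℚ) × ℚ)

/-- The scalings of the product recipe are non-zero. -/
theorem prodμ_ne_zero (i : Fin K) : prodμ a u v i ≠ 0 := by
  unfold prodμ
  split_ifs with h1 h2
  · exact one_ne_zero
  · exact h2
  · exact h1

/-- The product recipe makes both bounds `y`-free or `y` itself (one-slope hypothesis). -/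
theorem prod_bounds (i : Fin K)
    (hs : (u i).1 (Fin.last B) - prodα a u i = 0 ∨ (v i).1 (Fin.last B) - prodα a u i = 0) :
    ((pullC (prodμ a u v i) (prodα a u i) (prodδ a u v i) (u i)).1 (Fin.last B) = 0 ∨
      pullC (prodμ a u v i) (prodα a u i) (prodδ a u v i) (u i) = (Pi.single (Fin.last B) 1, 0)) ∧
    ((pullC (prodμ a u v i) (prodα a u i) (prodδ a u v i) (v i)).1 (Fin.last B) = 0 ∨
      pullC (prodμ a u v i) (prodα a u i) (prodδ a u v i) (v i) = (Pi.single (Fin.last B) 1, 0)) := by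
  by_cases h1 : (u i).1 (Fin.last B) - prodα a u i = 0
  · by_cases h2 : (v i).1 (Fin.last B) - prodα a u i = 0
    · refine ⟨Or.inl ?_, Or.inl ?_⟩
      · rw [pullC_fst_last, h1, zero_div]
      · rw [pullC_fst_last, h2, zero_div]
    · have hμ : prodμ a u v i = (v i).1 (Fin.last B) - prodα a u i := by simp [prodμ, h1, h2]
      have hδ : prodδ a u v i = (fun j => (v i).1 (Fin.castSucc j), (v i).2) := by simp [prodδ, h1, h2]
      refine ⟨Or.inl ?_, Or.inr ?_⟩
      · rw [pullC_fst_last, h1, zero_div]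
      · rw [hμ, hδ]
        exact pullC_eq_single _ _ h2 (v i) rfl
  · have h2 : (v i).1 (Fin.last B) - prodα a u i = 0 := hs.resolve_left h1
    have hμ : prodμ a u v i = (u i).1 (Fin.last B) - prodα a u i := by simp [prodμ, h1]
    have hδ : prodδ a u v i = (fun j => (u i).1 (Fin.castSucc j), (u i).2) := by simp [prodδ, h1]
    refine ⟨Or.inr ?_, Or.inl ?_⟩
    · rw [hμ, hδ]
      exact pullC_eq_single _ _ h1 (u i) rfl
    · rw [pullC_fst_last, h2, zero_div]

/-- **Product fibres with one sloped bound each** (the easy sub-case of `stub_rebaseSimplePos`,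
uniformly in the silent base coordinates): if every fibre has affine bounds (no mutual bound) and,
for a lettered fibre, one of the two bounds is parallel to the letter in `y`, then ONE per-fibre
affine pull-back (shear along the letter, rescale the other bound to `y` itself) lands in
`GG B 2 K`. -/
theorem good_product {m m' n₁ n₂ : ℕ} (s : KZ.IntegralRep (B + 1 + K))
    (M : Fin m' → (Fin (B + 1) → ℚ) × ℚ) (L : Fin m → (Fin B → ℚ) × ℚ) (e : Fin m → ℕ)
    (p : MvPolynomial (Fin B) ℚ) (ℓ₁ ℓ₂ : (Fin B → ℚ) × ℚ)
    (lo hi : Fin K → Fin K ⊕ ((Fin (B + 1) → ℚ) × ℚ))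
    (h12 : n₁ = 0 ∨ n₂ = 0) (hbd : Bornology.IsBounded s.domain) (hdom : s.domain = gDom B K m' M lo hi)
    (hint : EqOn s.integrand (glit B K p L e ℓ₁ ℓ₂ n₁ n₂ a) s.domain)
    (hlo : ∀ i, lo i = Sum.inr (u i)) (hhi : ∀ i, hi i = Sum.inr (v i))
    (hslope : ∀ i c, a i = some c →
      (u i).1 (Fin.last B) = c.1 (Fin.last B) ∨ (v i).1 (Fin.last B) = c.1 (Fin.last B)) :
    ∃ c ∈ AddSubgroup.closure (GGset B 2 K), KZ.of s - c ∈ KZ.relations := by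
  have hs : ∀ i, (u i).1 (Fin.last B) - prodα a u i = 0 ∨ (v i).1 (Fin.last B) - prodα a u i = 0 := by
    intro i
    rcases h : a i with _ | c
    · exact Or.inl (by simp [prodα, h])
    · rcases hslope i c h with h' | h'
      · exact Or.inl (by simp [prodα, h, h'])
      · exact Or.inr (by simp [prodα, h, h'])
  obtain ⟨s', -, hbd', hdom', hint', hrel⟩ := pull (prodμ a u v) (prodα a u) (prodδ a u v) s M L e p
    ℓ₁ ℓ₂ n₁ n₂ a lo hi hbd hdom hint (prodμ_ne_zero a u v)
    (fun i j hij => by rcases hij with h | h <;> [rw [hlo] at h; rw [hhi] at h] <;> cases h)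
  refine ⟨KZ.of s', AddSubgroup.subset_closure (mem_GGset_two s' M L e _ ℓ₁ ℓ₂ _ _ _ h12
    (fun i c hc => ?_) (fun i c hc => ?_) hbd' hdom' hint'), hrel⟩
  · rcases h : a i with _ | c₀
    · simp [pullA, h] at hc
    · simp only [pullA, h, Option.map_some, Option.some.injEq] at hc
      rw [← hc, pullC_fst_last]
      simp [prodα, h]
  · obtain ⟨hu, hv⟩ := prod_bounds a u v i (hs i)
    simp only [pullLo, pullHi, hlo, hhi] at hc
    split_ifs at hc <;> simp only [Sum.map_inr, Sum.inr.injEq] at hc <;>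
      rcases hc with rfl | rfl <;> assumption

end Product

end RebasePos

/-- **Registered part of `stub_rebaseSimplePos` (line `janus-bands`, v6): product fibres with one
letter-transverse bound.** A representation with the literal `GG B σ K` datum (any `σ`, any
`n₁ n₂` with `n₁ = 0 ∨ n₂ = 0`) all of whose fibre bounds are affine forms of the base (`hlo`,
`hhi`: no mutual bound) and such that every lettered fibre has a bound parallel to its letter in
`y` (`hslope`) is congruent modulo `KZ.relations` to an element of the literal class `GG B 2 K`:
ONE per-fibre affine pull-back (rule 2) shearing each fibre along its letter and rescaling the
other bound to the coordinate `y` itself (`RebasePos.good_product`). -/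
theorem rebaseSimplePos_product (B K m m' n₁ n₂ : ℕ) (s : KZ.IntegralRep (B + 1 + K)) (M : Fin m' → (Fin (B + 1) → ℚ) × ℚ) (L : Fin m → (Fin B → ℚ) × ℚ) (e : Fin m → ℕ) (p : MvPolynomial (Fin B) ℚ) (ℓ₁ ℓ₂ : (Fin B → ℚ) × ℚ) (a : Fin K → Option ((Fin (B + 1) → ℚ) × ℚ)) (lo hi : Fin K → Fin K ⊕ ((Fin (B + 1) → ℚ) × ℚ)) (u v : Fin K → (Fin (B + 1) → ℚ) × ℚ) (h12 : n₁ = 0 ∨ n₂ = 0) (hbd : Bornology.IsBounded s.domain) (hdom : s.domain = {z | (∀ j, 0 < ∑ i, ((M j).1 i : ℝ) * z (Fin.castAdd K i) + ((M j).2 : ℝ)) ∧ ∀ i, Sum.elim (fun j => z (Fin.natAdd (B + 1) j)) (fun c => ∑ i', (c.1 i' : ℝ) * z (Fin.castAdd K i') + (c.2 : ℝ)) (lo i) < z (Fin.natAdd (B + 1) i) ∧ z (Fin.natAdd (B + 1) i) < Sum.elim (fun j => z (Fin.natAdd (B + 1) j)) (fun c => ∑ i', (c.1 i' : ℝ) *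 z (Fin.castAdd K i') + (c.2 : ℝ)) (hi i)}) (hint : EqOn s.integrand (fun z => MvPolynomial.aeval (fun i => z (Fin.castAdd K (Fin.castSucc i))) p / (∏ j, (∑ i, ((L j).1 i : ℝ) * z (Fin.castAdd K (Fin.castSucc i)) + ((L j).2 : ℝ)) ^ e j) * ((z (Fin.castAdd K (Fin.last B)) - (∑ i, (ℓ₁.1 i : ℝ) * z (Fin.castAdd K (Fin.castSucc i)) + (ℓ₁.2 : ℝ))) ^ n₁ / (z (Fin.castAdd K (Fin.last B)) - (∑ i, (ℓ₂.1 i : ℝ) * z (Fin.castAdd K (Fin.castSucc i)) + (ℓ₂.2 : ℝ))) ^ n₂) * ∏ i, (a i).elim 1 (fun c => 1 / (z (Fin.natAdd (B + 1) i) - (∑ i', (c.1 i' : ℝ) * z (Fin.castAdd K i') + (c.2 : ℝ))))) s.domain) (hlo : ∀ i, lo i = Sum.inr (u i)) (hhi : ∀ i, hi i = Sum.inr (v i)) (hslope : ∀ i c, a i = some c → (u i).1 (Fin.last B) = c.1 (Fin.last B) ∨ (v i).1 (Fin.last B) = c.1 (Fin.last B)) : ∃ c ∈ AddSubgroup.closure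 {w : KZ.FormalRep | ∃ (m m' n₁ n₂ : ℕ) (s : KZ.IntegralRep (B + 1 + K)) (M : Fin m' → (Fin (B + 1) → ℚ) × ℚ) (L : Fin m → (Fin B → ℚ) × ℚ) (e : Fin m → ℕ) (p : MvPolynomial (Fin B) ℚ) (ℓ₁ ℓ₂ : (Fin B → ℚ) × ℚ) (a : Fin K → Option ((Fin (B + 1) → ℚ) × ℚ)) (lo hi : Fin K → Fin K ⊕ ((Fin (B + 1) → ℚ) × ℚ)), (n₁ = 0 ∨ n₂ = 0) ∧ (2 = 2 → (∀ i c, a i = some c → c.1 (Fin.last B) = 0) ∧ (∀ i c, (lo i = Sum.inr c ∨ hi i = Sum.inr c) → (c.1 (Fin.last B) = 0 ∨ c = (Pi.single (Fin.last B) 1, 0)))) ∧ Bornology.IsBounded s.domain ∧ s.domain = {z | (∀ j, 0 < ∑ i, ((M j).1 i : ℝ) * z (Fin.castAdd K i) + ((M j).2 : ℝ)) ∧ ∀ i, Sum.elim (fun j => z (Fin.natAdd (B + 1) j)) (fun c => ∑ i', (c.1 i' : ℝ) * z (Fin.castAdd K i') + (c.2 : ℝ)) (lo i) < z (Fin.natAdd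 (B + 1) i) ∧ z (Fin.natAdd (B + 1) i) < Sum.elim (fun j => z (Fin.natAdd (B + 1) j)) (fun c => ∑ i', (c.1 i' : ℝ) * z (Fin.castAdd K i') + (c.2 : ℝ)) (hi i)} ∧ EqOn s.integrand (fun z => MvPolynomial.aeval (fun i => z (Fin.castAdd K (Fin.castSucc i))) p / (∏ j, (∑ i, ((L j).1 i : ℝ) * z (Fin.castAdd K (Fin.castSucc i)) + ((L j).2 : ℝ)) ^ e j) * ((z (Fin.castAdd K (Fin.last B)) - (∑ i, (ℓ₁.1 i : ℝ) * z (Fin.castAdd K (Fin.castSucc i)) + (ℓ₁.2 : ℝ))) ^ n₁ / (z (Fin.castAdd K (Fin.last B)) - (∑ i, (ℓ₂.1 i : ℝ) * z (Fin.castAdd K (Fin.castSucc i)) + (ℓ₂.2 : ℝ))) ^ n₂) * ∏ i, (a i).elim 1 (fun c => 1 / (z (Fin.natAdd (B + 1) i) - (∑ i', (c.1 i' : ℝ) * z (Fin.castAdd K i') + (c.2 : ℝ))))) s.domain ∧ w = KZ.of s}, KZ.of s - c ∈ KZ.relations :=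
  RebasePos.good_product a u v s M L e p ℓ₁ ℓ₂ lo hi h12 hbd hdom hint hlo hhi hslope

end Summit.KontsevichZagierPeriods.ArrangementNormalForm.JanusBands
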